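import Literature.AlgebraicGeometry.Resolution.RegularSubschemeLocallyIrreducible
import HarnessLib

/-!
# A regular closed subscheme has ONE irreducible branch through each of its points: two distinct irreducible components
# (or two incomparable irreducible closed subsets covering a neighbourhood together with a third closed set) through a point
# force the reduced structure `V(𝓘_C)` to be NON-regular

Topic `Literature/AlgebraicGeometry/Resolution`. Sequel of `RegularSubschemeLocallyIrreducible.lean` (tree:
`exists_opens_isIrreducible_support_inter` — a regular closed subscheme of a locally Noetherian scheme is locally irreducible in the
ambient scheme, Stacks 0357). Here the contrapositive is packaged in the two forms in which it is USED on explicit singular loci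
(cell res-hironaka, D-0124 / D-0130 test bed: a singular locus that is a union of ≥ 2 curves / hypersurface germs through the point —
Hauser's kangaroo `V(x,y) ∪ V(x,z) ∪ V(x,y+z)`, cylinders over it, Hironaka's W–Q specimen `L_w ∪ C₃ ∪ γ̄ ∪ C₄` — carries NO regular
reduced subscheme structure, so «regular singular locus» packages do not apply there):

* `subset_of_inter_open_subset_of_isPreirreducible` — density bookkeeping: if `Z` is preirreducible, `y ∈ Z ∩ V` with `V` open, and
  `Z ∩ V ⊆ P` with `P` closed, then `Z ⊆ P`.
* `exists_irreducible_closed_superset_of_isRegular_vanishingIdeal` — if `V(𝓘_C)` is regular (`C` closed) and `y ∈ C`, there is an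
  IRREDUCIBLE closed `S ⊆ C` containing EVERY preirreducible `Z ⊆ C` through `y`.
* `not_isRegular_vanishingIdeal_of_two_components` — two DISTINCT irreducible subsets of `C` through a common point, each maximal among
  the irreducible subsets of `C` (irreducible components of `C`), ⇒ `V(𝓘_C)` is not regular.
* `not_isRegular_vanishingIdeal_of_cover` — cover form: `Z₁ ∪ Z₂ ⊆ C ⊆ Z₁ ∪ Z₂ ∪ T` with `Z₁, Z₂` preirreducible through a common point,
  `Z₁, Z₂, T` closed, `Z₁ ⊄ Z₂`, `Z₂ ⊄ Z₁`, `Z₁ ⊄ T` ⇒ `V(𝓘_C)` is not regular (the shape used in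
  `Summits/…/Theorems/Rescue/BedKangarooResumeShape.lean`, whose `not_isRegular_vanishingIdeal_of_two_lines` is the 𝔸³ instance).
Everything PROVED; no definitions, no named facts. AI-produced formalisation.

## Sources
* The Stacks Project, Tag 0357 (a normal, in particular a regular, local ring is a domain; irreducible components of a normal
  locally Noetherian scheme are disjoint) and Tag 004W (irreducible components). [StacksProject]
* A. Grothendieck, ÉGA IV₂ (1965), Prop. 5.8.5 / (5.8.6) (regular ⇒ normal ⇒ locally integral). [EGAIV2]
-/

noncomputable section

open CategoryTheory TopologicalSpace
open _root_.AlgebraicGeometry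

namespace Literature.AlgebraicGeometry.Resolution

open Scheme.IdealSheafData

universe u

variable {X : Scheme.{u}}

/-- **Density bookkeeping**: a preirreducible `Z` meeting the open `V` lies in every closed `P ⊇ Z ∩ V` (a non-empty open part of a
preirreducible set is dense in it: `Z ⊆ closure (Z ∩ V) ∪ Vᶜ` with both closed). [cite: StacksProject, Tag 004W (irreducible sets: non-empty opens are dense)] -/
theorem subset_of_inter_open_subset_of_isPreirreducible {Z V P : Set X} (hZ : IsPreirreducible Z) (hV : IsOpen V) (hP : IsClosed P)
    {y : X} (hyZ : y ∈ Z) (hyV : y ∈ V) (h : Z ∩ V ⊆ P) : Z ⊆ P := by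
  have hcov : Z ⊆ closure (Z ∩ V) ∪ Vᶜ := fun z hz => by
    by_cases hzV : z ∈ V
    · exact Or.inl (subset_closure ⟨hz, hzV⟩)
    · exact Or.inr hzV
  rcases (isPreirreducible_iff_isClosed_union_isClosed.mp hZ) _ _ isClosed_closure hV.isClosed_compl hcov with h1 | h1
  · exact h1.trans ((hP.closure_subset_iff).mpr h)
  · exact absurd hyV (h1 hyZ)

variable [IsLocallyNoetherian X]

/-- **A regular `V(𝓘_C)` has ONE irreducible branch through each point**: if the reduced closed subscheme on the closed set `C` is
regular and `y ∈ C`, there is an irreducible closed `S ⊆ C` containing every preirreducible subset of `C` through `y` (`S` = the closure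
of an irreducible neighbourhood trace `C ∩ V`, tree `exists_opens_isIrreducible_support_inter`). [cite: StacksProject, Tag 0357] -/
theorem exists_irreducible_closed_superset_of_isRegular_vanishingIdeal (C : Closeds X)
    (hreg : Scheme.IsRegular (vanishingIdeal C).subscheme) {y : X} (hy : y ∈ (C : Set X)) :
    ∃ S : Set X, IsIrreducible S ∧ IsClosed S ∧ S ⊆ (C : Set X) ∧
      ∀ Z : Set X, IsPreirreducible Z → y ∈ Z → Z ⊆ (C : Set X) → Z ⊆ S := by
  have hsupp : ((vanishingIdeal C).support : Set X) = C := by rw [coe_support_vanishingIdeal]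
  obtain ⟨V, hyV, hirr⟩ := exists_opens_isIrreducible_support_inter (vanishingIdeal C) hreg (y := y) (by rw [hsupp]; exact hy)
  rw [hsupp] at hirr
  refine ⟨closure ((C : Set X) ∩ V), hirr.closure, isClosed_closure,
    (C.isClosed.closure_subset_iff).mpr Set.inter_subset_left, fun Z hZ hyZ hZC => ?_⟩
  exact subset_of_inter_open_subset_of_isPreirreducible hZ V.isOpen isClosed_closure hyZ hyV
    ((Set.inter_subset_inter_left _ hZC).trans subset_closure)

/-- **Two distinct irreducible components through a point ⇒ `V(𝓘_C)` is NOT regular.** Here «component» = an irreducible subset of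
`C` maximal among the irreducible subsets of `C`; both pass through `y`. [cite: StacksProject, Tag 0357 (regular ⇒ irreducible components pairwise disjoint)] -/
theorem not_isRegular_vanishingIdeal_of_two_components (C : Closeds X) {Z₁ Z₂ : Set X} {y : X}
    (hZ₁ : IsIrreducible Z₁) (hZ₂ : IsIrreducible Z₂) (hy₁ : y ∈ Z₁) (hy₂ : y ∈ Z₂)
    (h₁ : Z₁ ⊆ (C : Set X)) (h₂ : Z₂ ⊆ (C : Set X))
    (hmax₁ : ∀ S : Set X, IsIrreducible S → S ⊆ (C : Set X) → Z₁ ⊆ S → S = Z₁)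
    (hmax₂ : ∀ S : Set X, IsIrreducible S → S ⊆ (C : Set X) → Z₂ ⊆ S → S = Z₂) (hne : Z₁ ≠ Z₂) :
    ¬ Scheme.IsRegular (vanishingIdeal C).subscheme := by
  intro hreg
  obtain ⟨S, hS, -, hSC, hall⟩ := exists_irreducible_closed_superset_of_isRegular_vanishingIdeal C hreg (h₁ hy₁)
  have e₁ := hmax₁ S hS hSC (hall Z₁ hZ₁.isPreirreducible hy₁ h₁)
  have e₂ := hmax₂ S hS hSC (hall Z₂ hZ₂.isPreirreducible hy₂ h₂)
  exact hne (e₁.symm.trans e₂)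

/-- **Cover form**: if `Z₁ ∪ Z₂ ⊆ C ⊆ Z₁ ∪ Z₂ ∪ T` with `Z₁, Z₂` preirreducible through a common point `y`, `Z₁, Z₂, T` closed, and
`Z₁ ⊄ Z₂`, `Z₂ ⊄ Z₁`, `Z₁ ⊄ T`, then `V(𝓘_C)` is NOT regular: the irreducible branch `S ⊇ Z₁ ∪ Z₂` of the previous lemma lies in one
of the three closed pieces. [cite: StacksProject, Tag 0357 (regular ⇒ locally irreducible) and Tag 004W] -/
theorem not_isRegular_vanishingIdeal_of_cover (C : Closeds X) {Z₁ Z₂ T : Set X} {y : X}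
    (hZ₁ : IsPreirreducible Z₁) (hZ₂ : IsPreirreducible Z₂) (hZ₁c : IsClosed Z₁) (hZ₂c : IsClosed Z₂) (hT : IsClosed T)
    (hy₁ : y ∈ Z₁) (hy₂ : y ∈ Z₂) (h₁ : Z₁ ⊆ (C : Set X)) (h₂ : Z₂ ⊆ (C : Set X)) (hC : (C : Set X) ⊆ Z₁ ∪ Z₂ ∪ T)
    (h12 : ¬ Z₁ ⊆ Z₂) (h21 : ¬ Z₂ ⊆ Z₁) (h1T : ¬ Z₁ ⊆ T) :
    ¬ Scheme.IsRegular (vanishingIdeal C).subscheme := by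
  intro hreg
  obtain ⟨S, hS, -, hSC, hall⟩ := exists_irreducible_closed_superset_of_isRegular_vanishingIdeal C hreg (h₁ hy₁)
  have hS₁ : Z₁ ⊆ S := hall Z₁ hZ₁ hy₁ h₁
  have hS₂ : Z₂ ⊆ S := hall Z₂ hZ₂ hy₂ h₂
  have hpre := isPreirreducible_iff_isClosed_union_isClosed.mp hS.isPreirreducible
  rcases hpre (Z₁ ∪ Z₂) T (hZ₁c.union hZ₂c) hT (hSC.trans hC) with h | h
  · rcases hpre Z₁ Z₂ hZ₁c hZ₂c h with h' | h'
    · exact h21 (hS₂.trans h')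
    · exact h12 (hS₁.trans h')
  · exact h1T (hS₁.trans h)

end Literature.AlgebraicGeometry.Resolution

end
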